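import Literature.NumberTheory.EllipticCurves.SzpiroFreyCurveProofs
import Literature.NumberTheory.DiophantineGeometry.ValuationProductElliptic
import HarnessLib

/-!
# The `ε` in the valuation-product bounds cannot be dropped: the Mersenne–Frey family (proofs)

Topic `NumberTheory/EllipticCurves`; namespace `Literature.NumberTheory.EllipticCurves`. A proofs
file (theorems only, no definitions), companion of
`Literature.NumberTheory.DiophantineGeometry.ValuationProductElliptic` (Pasten's
`∏_{p ∣ N_E^*} v_p(Δ_E)` = `multiplicativeValuationProduct`, Theorem 1.12 / Corollary 16.2 /
Conjecture 1.14 of [PastenShimura2024]) and of `SzpiroFreyCurveProofs` (the discharged Frey facts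
`conductorNorm_freyCurve_of_mod_holds`, `minimalDiscriminantNorm_freyCurve_of_mod_holds`,
Bombieri–Gubler Ex. 12.5.10 / Serre 1987 §4.1).

The family `y² = x (x + 1) (x + 2ⁿ)` = `freyCurve (-1) (2 ^ n)` (the Frey curve of
`(2ⁿ - 1) + 1 = 2ⁿ` in Serre's normalisation `a = -1 ≡ -1 (4)`, `32 ∣ b = 2ⁿ`, `n ≥ 5`) is
computed exactly: `N = rad (2ⁿ (2ⁿ - 1)) = 2 · rad (2ⁿ - 1) < 2ⁿ⁺¹`, `Δ_min = 2^(2n-8) (2ⁿ - 1)²`,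
`T := ∏_{p ∥ N} v_p(Δ_min) = (2n - 8) · ∏_{p ∣ 2ⁿ-1} 2 v_p(2ⁿ - 1) ≥ 2n - 8 (> 2 log₂ N - 10)`, with
odd multiplicative primes exactly the prime factors of `2ⁿ - 1`. This is the valuation-product
analogue of Masser's remark that Szpiro needs its `ε` (barrier
`Literature.Barriers.ABC.SzpiroEpsilonCannotBeDropped`, MANY primes): here ONE relation with a
large power of `2` suffices, and the conclusions are

* `valuationProduct_unbounded_semistable` — for every `C` there is a SEMISTABLE elliptic curve with
  `∏_{p ∣ N} v_p(Δ_min) > C` (so the exponent in Pasten's Theorem 1.12 / Conjecture 1.14 shape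
  cannot be `0`); quantitatively `T > 2 log₂ N - 10` along the family
  (`le_multiplicativeValuationProduct_freyCurve_mersenne`, `conductorNorm_freyCurve_mersenne_lt`);
* `manyPrimeValuationProduct_false_without_eps` — unconditionally, no uniform bound on `T` for
  curves semistable away from `2` with `≥ 4` odd multiplicative primes (`n = 12k`:
  `3 · 5 · 7 · 13 ∣ 2ⁿ - 1`) — the `ε = 0` case of the crux `ManyPrimeValuationProduct` of route
  ABC/RibetTakahashiSplit; `valuationProduct_false_without_eps` — same without the prime count;
* `fewPrimeValuationProduct_false_without_eps_of_frequently_omega_le_three` — no uniform bound on the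
  FEW-prime class (`≤ 3` odd multiplicative primes; crux `FewPrimeValuationProduct`, stmt-ABC-1563)
  PROVIDED `ω(2ⁿ - 1) ≤ 3` for unboundedly many `n` (e.g. infinitely many Mersenne primes); at truth
  level this also follows from Chen's theorem in Goldbach form (`2ⁿ = ℓ + P₂`), not in Mathlib;
* `fewPrime_witness_13`, `fewPrime_witness_127` — explicit few-prime members with ONE odd
  multiplicative prime: `N = 16382`, `T = 36`, and `N = 2 (2¹²⁷ - 1)`, `T = 492` (Lucas–Lehmer in the
  kernel); hence `fewPrimeValuationProduct_uniform_const_ge` (any uniform constant is `≥ 492`) and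
  `not_fewPrimeValuationProduct_le_five` (Mestre–Oesterlé's prime-conductor bound `v_p(Δ) ≤ 5`,
  `mestreOesterle1989_thm_1`, does not extend verbatim to the few-prime class).

(Why the `ε > 0` statements themselves resist refutation: with `≤ 4` factors each
`≤ log₂ |Δ_min|`, Szpiro's conjecture implies `T ≤ C_ε N^ε` on the few-prime class — recorded by the
cdisprove seat of stmt-ABC-1563 as item evidence `Disproof.lean`, theorem
`fewPrimeValuationProduct_of_szpiro`.)

## References

* [PastenShimura2024] H. Pasten, *Shimura curves and the abc conjecture*, J. Number Theory 254
  (2024) 214–335 (arXiv:1705.09251): Thm 1.12, Conj. 1.14, Cor. 16.2.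
* [BombieriGubler2006] E. Bombieri, W. Gubler, *Heights in Diophantine Geometry*, CUP 2006,
  Example 12.5.10 (Frey curve: minimal model, conductor `rad`, `Δ_min = 2⁻⁸(abc)²`).
* [Masser1990] D. W. Masser, *Note on a conjecture of Szpiro*, Astérisque 183 (1990), 19–23
  (Lemma 1: the same normalisation; the `ε` of Szpiro cannot be dropped).
-/

noncomputable section

namespace Literature.NumberTheory.EllipticCurves

open Literature.NumberTheory.DiophantineGeometry
open UniqueFactorizationMonoid WeierstrassCurve

/-! ## The family `freyCurve (-1) (2 ^ n)` -/

section Family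

variable {n : ℕ}

/-- `-1` and `2ⁿ` are coprime. [folklore] -/
private theorem hcop (n : ℕ) : IsCoprime (-1 : ℤ) (2 ^ n) := isCoprime_one_left.neg_left

/-- `-1 ≡ -1 (mod 4)` (Serre's normalisation of `a`). [folklore] -/
private theorem hmod : (-1 : ℤ) ≡ -1 [ZMOD 4] := Int.ModEq.refl _

/-- `32 ∣ 2ⁿ` for `n ≥ 5` (Serre's normalisation of `b`). [folklore] -/
private theorem h32 (hn : 5 ≤ n) : (32 : ℤ) ∣ 2 ^ n := by
  rw [show (32 : ℤ) = 2 ^ 5 by norm_num]; exact pow_dvd_pow 2 hn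

/-- `(2ⁿ - 1 : ℕ)` cast to `ℤ`. [folklore] -/
private theorem mersenne_cast (n : ℕ) : ((mersenne n : ℕ) : ℤ) = 2 ^ n - 1 := by
  have h := congrArg (fun k : ℕ => (k : ℤ)) (succ_mersenne n)
  push_cast at h
  linear_combination h

/-- `ab(a+b) = -(2ⁿ (2ⁿ - 1))` for `(a, b) = (-1, 2ⁿ)`. [folklore] -/
private theorem prod_eq (n : ℕ) :
    (-1 : ℤ) * 2 ^ n * (-1 + 2 ^ n) = -((2 ^ n * mersenne n : ℕ) : ℤ) := by
  push_cast [mersenne_cast]; ring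

/-- `2ⁿ - 1 ≠ 0` for `n ≥ 1`. [folklore] -/
private theorem mersenne_ne_zero (hn : 1 ≤ n) : mersenne n ≠ 0 :=
  (mersenne_pos.mpr hn).ne'

/-- `ab(a+b) ≠ 0` for `(a, b) = (-1, 2ⁿ)`, `n ≥ 1`. [folklore] -/
private theorem hne (hn : 1 ≤ n) : (-1 : ℤ) * 2 ^ n * (-1 + 2 ^ n) ≠ 0 := by
  rw [prod_eq, neg_ne_zero, Int.natCast_ne_zero]
  exact mul_ne_zero (pow_ne_zero _ two_ne_zero) (mersenne_ne_zero hn)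

/-- `y² = x(x+1)(x+2ⁿ)` is an elliptic curve. [folklore] -/
theorem isElliptic_freyCurve_mersenne (hn : 1 ≤ n) : (freyCurve (-1) (2 ^ n)).IsElliptic :=
  isElliptic_freyCurve (hne hn)

/-- `N = rad (2ⁿ (2ⁿ - 1))` for `n ≥ 5` (Serre 1987 §4.1; B–G Ex. 12.5.10; discharged fact
`conductorNorm_freyCurve_of_mod_holds`). [cite: BombieriGubler2006, Ex. 12.5.10] -/
theorem conductorNorm_freyCurve_mersenne (hn : 5 ≤ n) :
    (freyCurve (-1) (2 ^ n)).conductorNorm ℤ = radical (2 ^ n * mersenne n) := by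
  have h := conductorNorm_freyCurve_of_mod_holds (-1) (2 ^ n) (hcop n) (hne (by omega)) hmod (h32 hn)
  rw [h, prod_eq, UniqueFactorizationDomain.radical_neg, ← Int.radical_natAbs_eq_radical]
  simp only [Int.natAbs_natCast]

/-- `Δ_min = 2^(2n-8) (2ⁿ - 1)²` for `n ≥ 5` (discharged fact
`minimalDiscriminantNorm_freyCurve_of_mod_holds`). [cite: BombieriGubler2006, Ex. 12.5.10] -/
theorem minimalDiscriminantNorm_freyCurve_mersenne (hn : 5 ≤ n) :
    (freyCurve (-1) (2 ^ n)).minimalDiscriminantNorm ℤ = 2 ^ (2 * n - 8) * mersenne n ^ 2 := by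
  have h := minimalDiscriminantNorm_freyCurve_of_mod_holds (-1) (2 ^ n) (hcop n) (hne (by omega))
    hmod (h32 hn)
  rw [prod_eq, neg_sq, ← Nat.cast_pow, Int.natAbs_natCast, mul_pow, ← pow_mul,
    show n * 2 = 8 + (2 * n - 8) by omega, pow_add, mul_assoc] at h
  exact Nat.eq_of_mul_eq_mul_left (by positivity) h

/-- `2ⁿ - 1` is odd. [folklore] -/
private theorem two_notMem_primeFactors_mersenne (hn : 1 ≤ n) : 2 ∉ (mersenne n).primeFactors :=
  fun h => (mersenne_odd.mpr (by omega)).not_two_dvd_nat (Nat.dvd_of_mem_primeFactors h)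

/-- Prime factors of `2ⁿ (2ⁿ - 1)`. [folklore] -/
private theorem primeFactors_two_pow_mul_mersenne (hn : 1 ≤ n) :
    (2 ^ n * mersenne n).primeFactors = insert 2 (mersenne n).primeFactors := by
  rw [Nat.primeFactors_mul (pow_ne_zero _ two_ne_zero) (mersenne_ne_zero hn),
    Nat.primeFactors_pow _ (by omega : n ≠ 0), Nat.prime_two.primeFactors, Finset.insert_eq]

/-- The bad primes are `2` and the primes of `2ⁿ - 1`. [folklore] -/
theorem primeFactors_conductorNorm_freyCurve_mersenne (hn : 5 ≤ n) :
    ((freyCurve (-1) (2 ^ n)).conductorNorm ℤ).primeFactors = insert 2 (mersenne n).primeFactors := by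
  rw [conductorNorm_freyCurve_mersenne hn, Nat.primeFactors_radical,
    primeFactors_two_pow_mul_mersenne (by omega)]

/-- The curve is semistable: squarefree conductor. [folklore] -/
theorem squarefree_conductorNorm_freyCurve_mersenne (hn : 5 ≤ n) :
    Squarefree ((freyCurve (-1) (2 ^ n)).conductorNorm ℤ) := by
  rw [conductorNorm_freyCurve_mersenne hn]; exact squarefree_radical

/-- `N = 2 · rad (2ⁿ - 1)`. [folklore] -/
theorem conductorNorm_freyCurve_mersenne_eq (hn : 5 ≤ n) :
    (freyCurve (-1) (2 ^ n)).conductorNorm ℤ = 2 * radical (mersenne n) := by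
  rw [conductorNorm_freyCurve_mersenne hn, Nat.radical_eq_prod_primeFactors,
    primeFactors_two_pow_mul_mersenne (by omega),
    Finset.prod_insert (two_notMem_primeFactors_mersenne (by omega)), Nat.radical_eq_prod_primeFactors]

/-- `N < 2ⁿ⁺¹`. [folklore] -/
theorem conductorNorm_freyCurve_mersenne_lt (hn : 5 ≤ n) :
    (freyCurve (-1) (2 ^ n)).conductorNorm ℤ < 2 ^ (n + 1) := by
  rw [conductorNorm_freyCurve_mersenne_eq hn, pow_succ']
  have h1 : radical (mersenne n) ≤ mersenne n :=
    Nat.radical_le_self_iff.mpr (mersenne_ne_zero (by omega))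
  have h2 : mersenne n < 2 ^ n := by rw [← succ_mersenne]; exact Nat.lt_succ_self _
  calc 2 * radical (mersenne n) ≤ 2 * mersenne n := Nat.mul_le_mul_left 2 h1
    _ < 2 * 2 ^ n := Nat.mul_lt_mul_of_pos_left h2 two_pos

/-- `v₂(Δ_min) = 2n - 8`. [folklore] -/
theorem factorization_two_minimalDiscriminantNorm_freyCurve_mersenne (hn : 5 ≤ n) :
    ((freyCurve (-1) (2 ^ n)).minimalDiscriminantNorm ℤ).factorization 2 = 2 * n - 8 := by
  have h2 : ¬ 2 ∣ mersenne n := (mersenne_odd.mpr (by omega)).not_two_dvd_nat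
  rw [minimalDiscriminantNorm_freyCurve_mersenne hn,
    Nat.factorization_mul (pow_ne_zero _ two_ne_zero) (pow_ne_zero _ (mersenne_ne_zero (by omega)))]
  simp [Nat.factorization_pow, Nat.prime_two.factorization_self, Nat.factorization_eq_zero_of_not_dvd h2]

/-- `v_p(Δ_min) = 2 v_p(2ⁿ - 1)` at an odd bad prime. [folklore] -/
theorem factorization_odd_minimalDiscriminantNorm_freyCurve_mersenne (hn : 5 ≤ n) {p : ℕ}
    (hp : p ∈ (mersenne n).primeFactors) :
    ((freyCurve (-1) (2 ^ n)).minimalDiscriminantNorm ℤ).factorization p =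
      2 * (mersenne n).factorization p := by
  have hp2 : (2 : ℕ) ≠ p := fun h => two_notMem_primeFactors_mersenne (n := n) (by omega) (h ▸ hp)
  rw [minimalDiscriminantNorm_freyCurve_mersenne hn,
    Nat.factorization_mul (pow_ne_zero _ two_ne_zero) (pow_ne_zero _ (mersenne_ne_zero (by omega)))]
  simp [Nat.factorization_pow, Nat.prime_two.factorization, hp2]

/-- **`T = (2n - 8) · ∏_{p ∣ 2ⁿ - 1} 2 v_p(2ⁿ - 1)`**, exactly. [folklore] -/
theorem multiplicativeValuationProduct_freyCurve_mersenne (hn : 5 ≤ n) :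
    multiplicativeValuationProduct (freyCurve (-1) (2 ^ n)) =
      (2 * n - 8) * ∏ p ∈ (mersenne n).primeFactors, 2 * (mersenne n).factorization p := by
  rw [multiplicativeValuationProduct_eq_of_squarefree _ (squarefree_conductorNorm_freyCurve_mersenne hn),
    primeFactors_conductorNorm_freyCurve_mersenne hn,
    Finset.prod_insert (two_notMem_primeFactors_mersenne (by omega)),
    factorization_two_minimalDiscriminantNorm_freyCurve_mersenne hn]
  congr 1
  exact Finset.prod_congr rfl fun p hp =>
    factorization_odd_minimalDiscriminantNorm_freyCurve_mersenne hn hp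

/-- **`T ≥ 2n - 8`** along the family (`> 2 log₂ N - 10`). [folklore] -/
theorem le_multiplicativeValuationProduct_freyCurve_mersenne (hn : 5 ≤ n) :
    2 * n - 8 ≤ multiplicativeValuationProduct (freyCurve (-1) (2 ^ n)) := by
  rw [multiplicativeValuationProduct_freyCurve_mersenne hn]
  refine Nat.le_mul_of_pos_right _ (Finset.prod_pos fun p hp => ?_)
  have := (Nat.prime_of_mem_primeFactors hp).factorization_pos_of_dvd (mersenne_ne_zero (by omega))
    (Nat.dvd_of_mem_primeFactors hp)
  omega

/-- The crux's first hypothesis (semistable away from `2`) holds for the family. [folklore] -/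
theorem freyCurve_mersenne_hyp₁ (hn : 5 ≤ n) :
    ∀ p : ℕ, p.Prime → p ≠ 2 → ¬ p ^ 2 ∣ (freyCurve (-1) (2 ^ n)).conductorNorm ℤ := by
  intro p hp _ h
  exact Nat.squarefree_iff_prime_squarefree.mp (squarefree_conductorNorm_freyCurve_mersenne hn) p hp
    (by simpa [sq] using h)

/-- The crux's set of odd multiplicative primes is, for the family, `primeFactors (2ⁿ - 1)`.
[folklore] -/
theorem oddMultiplicativePrimes_freyCurve_mersenne (hn : 5 ≤ n) :
    ((freyCurve (-1) (2 ^ n)).conductorNorm ℤ).primeFactors.filter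
        (fun p => p ≠ 2 ∧ ¬ p ^ 2 ∣ (freyCurve (-1) (2 ^ n)).conductorNorm ℤ) =
      (mersenne n).primeFactors := by
  ext p
  simp only [Finset.mem_filter, primeFactors_conductorNorm_freyCurve_mersenne hn, Finset.mem_insert]
  constructor
  · rintro ⟨h | h, hp2, -⟩
    · exact absurd h hp2
    · exact h
  · intro h
    have hp2 : p ≠ 2 := fun h2 => two_notMem_primeFactors_mersenne (n := n) (by omega) (h2 ▸ h)
    exact ⟨Or.inr h, hp2, freyCurve_mersenne_hyp₁ hn p (Nat.prime_of_mem_primeFactors h) hp2⟩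

end Family

/-! ## `ε` cannot be dropped -/

/-- **H_ε is load-bearing for the crux (conditional form).** If `ω(2ⁿ - 1) ≤ 3` for unboundedly many
`n`, there is NO uniform constant `C` with `T(E) ≤ C` on the few-prime class: the crux with `ε = 0`
is false. [folklore] -/
theorem fewPrimeValuationProduct_false_without_eps_of_frequently_omega_le_three
    (H : ∀ N : ℕ, ∃ n, N ≤ n ∧ (mersenne n).primeFactors.card ≤ 3) :
    ¬ ∃ C : ℝ, ∀ (W : WeierstrassCurve ℚ) [W.IsElliptic],
      (∀ p : ℕ, p.Prime → p ≠ 2 → ¬ p ^ 2 ∣ W.conductorNorm ℤ) →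
      ((W.conductorNorm ℤ).primeFactors.filter
          (fun p => p ≠ 2 ∧ ¬ p ^ 2 ∣ W.conductorNorm ℤ)).card ≤ 3 →
      (multiplicativeValuationProduct W : ℝ) ≤ C := by
  rintro ⟨C, hC⟩
  obtain ⟨n, hn, hω⟩ := H (⌈C⌉₊ + 5)
  haveI := isElliptic_freyCurve_mersenne (n := n) (by omega)
  have h := hC (freyCurve (-1) (2 ^ n)) (freyCurve_mersenne_hyp₁ (by omega))
    (by rw [oddMultiplicativePrimes_freyCurve_mersenne (by omega)]; exact hω)
  have hT : ((2 * n - 8 : ℕ) : ℝ) ≤ multiplicativeValuationProduct (freyCurve (-1) (2 ^ n)) := by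
    exact_mod_cast le_multiplicativeValuationProduct_freyCurve_mersenne (n := n) (by omega)
  have h2 : (⌈C⌉₊ : ℝ) < (2 * n - 8 : ℕ) := by exact_mod_cast (by omega : ⌈C⌉₊ < 2 * n - 8)
  have h3 : C ≤ ⌈C⌉₊ := Nat.le_ceil C
  linarith

/-- `3 · 5 · 7 · 13 ∣ 2¹² - 1 ∣ 2¹²ᵏ - 1`: four odd prime factors. [folklore] -/
private theorem four_le_card_primeFactors_mersenne (k : ℕ) (hk : 1 ≤ k) :
    4 ≤ (mersenne (12 * k)).primeFactors.card := by
  have hdvd : mersenne 12 ∣ mersenne (12 * k) := by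
    simpa only [mersenne, one_pow, pow_mul] using Nat.sub_dvd_pow_sub_pow (2 ^ 12) 1 k
  have hsub : ({3, 5, 7, 13} : Finset ℕ) ⊆ (mersenne (12 * k)).primeFactors := by
    intro p hp
    simp only [Finset.mem_insert, Finset.mem_singleton] at hp
    have hm : mersenne (12 * k) ≠ 0 := mersenne_ne_zero (by omega)
    have h12 : mersenne 12 = 4095 := by norm_num [mersenne]
    rw [h12] at hdvd
    rcases hp with rfl | rfl | rfl | rfl <;>
      exact Nat.mem_primeFactors.mpr ⟨by norm_num, dvd_trans (by norm_num) hdvd, hm⟩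
  exact le_trans (by decide) (Finset.card_le_card hsub)

/-- **Unconditionally, `ε` cannot be dropped from the sibling crux `ManyPrimeValuationProduct`**
(stmt-ABC-1561): `freyCurve (-1) (2^(12k))` has the odd multiplicative primes `3, 5, 7, 13, …` and
`T ≥ 24k - 8`. [folklore] -/
theorem manyPrimeValuationProduct_false_without_eps :
    ¬ ∃ C : ℝ, ∀ (W : WeierstrassCurve ℚ) [W.IsElliptic],
      (∀ p : ℕ, p.Prime → p ≠ 2 → ¬ p ^ 2 ∣ W.conductorNorm ℤ) →
      4 ≤ ((W.conductorNorm ℤ).primeFactors.filter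
          (fun p => p ≠ 2 ∧ ¬ p ^ 2 ∣ W.conductorNorm ℤ)).card →
      (multiplicativeValuationProduct W : ℝ) ≤ C := by
  rintro ⟨C, hC⟩
  set n := 12 * (⌈C⌉₊ + 1) with hn
  have hn5 : 5 ≤ n := by omega
  haveI := isElliptic_freyCurve_mersenne (n := n) (by omega)
  have h := hC (freyCurve (-1) (2 ^ n)) (freyCurve_mersenne_hyp₁ hn5)
    (by rw [oddMultiplicativePrimes_freyCurve_mersenne hn5]
        exact four_le_card_primeFactors_mersenne _ (by omega))
  have hT : ((2 * n - 8 : ℕ) : ℝ) ≤ multiplicativeValuationProduct (freyCurve (-1) (2 ^ n)) := by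
    exact_mod_cast le_multiplicativeValuationProduct_freyCurve_mersenne hn5
  have h2 : (⌈C⌉₊ : ℝ) < (2 * n - 8 : ℕ) := by exact_mod_cast (by omega : ⌈C⌉₊ < 2 * n - 8)
  have h3 : C ≤ ⌈C⌉₊ := Nat.le_ceil C
  linarith

/-- **Unconditionally, `ε` cannot be dropped once the `≤ 3` hypothesis is dropped** (the union of
the two cruxes, Pasten's Conjecture 1.14 shape for curves semistable away from `2`). [folklore] -/
theorem valuationProduct_false_without_eps :
    ¬ ∃ C : ℝ, ∀ (W : WeierstrassCurve ℚ) [W.IsElliptic],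
      (∀ p : ℕ, p.Prime → p ≠ 2 → ¬ p ^ 2 ∣ W.conductorNorm ℤ) →
      (multiplicativeValuationProduct W : ℝ) ≤ C := by
  rintro ⟨C, hC⟩
  exact manyPrimeValuationProduct_false_without_eps ⟨C, fun W _ h₁ _ => hC W h₁⟩

/-- **The exponent in Pasten's Theorem 1.12 / Conjecture 1.14 shape cannot be `0`.** For every `C`
there is a SEMISTABLE elliptic curve over `ℚ` with `∏_{p ∣ N} v_p(Δ_min) > C` (namely
`y² = x(x+1)(x+2ⁿ)`, `n = C + 5`, whose product is `≥ 2n - 8 > 2 log₂ N - 10`). [folklore] -/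
theorem valuationProduct_unbounded_semistable (C : ℕ) :
    ∃ (W : WeierstrassCurve ℚ), W.IsElliptic ∧ Squarefree (W.conductorNorm ℤ) ∧
      C < ∏ p ∈ (W.conductorNorm ℤ).primeFactors, (W.minimalDiscriminantNorm ℤ).factorization p := by
  refine ⟨freyCurve (-1) (2 ^ (C + 5)), isElliptic_freyCurve_mersenne (by omega),
    squarefree_conductorNorm_freyCurve_mersenne (by omega), ?_⟩
  rw [← multiplicativeValuationProduct_eq_of_squarefree _
    (squarefree_conductorNorm_freyCurve_mersenne (by omega))]
  have := le_multiplicativeValuationProduct_freyCurve_mersenne (n := C + 5) (by omega)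
  omega

/-! ## Explicit members of the few-prime class with large `T` -/

/-- `rad p = p` for a prime `p`. [folklore] -/
private theorem radical_prime {p : ℕ} (hp : p.Prime) : radical p = p := by
  rw [Nat.radical_eq_prod_primeFactors, hp.primeFactors, Finset.prod_singleton]

/-- `∏_{q ∣ p} 2 v_q(p) = 2` for a prime `p`. [folklore] -/
private theorem prod_prime {p : ℕ} (hp : p.Prime) :
    ∏ q ∈ p.primeFactors, 2 * p.factorization q = 2 := by
  rw [hp.primeFactors, Finset.prod_singleton, hp.factorization_self]

/-- `n = 13` (`2¹³ - 1 = 8191` prime): `y² = x(x+1)(x+2¹³)` is semistable with bad primes `{2, 8191}`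
(ONE odd multiplicative prime), `N = 16382`, `T = 18 · 2 = 36`. [folklore] -/
theorem fewPrime_witness_13 :
    (freyCurve (-1) (2 ^ 13)).IsElliptic ∧
    (∀ p : ℕ, p.Prime → p ≠ 2 → ¬ p ^ 2 ∣ (freyCurve (-1) (2 ^ 13)).conductorNorm ℤ) ∧
    (((freyCurve (-1) (2 ^ 13)).conductorNorm ℤ).primeFactors.filter
        (fun p => p ≠ 2 ∧ ¬ p ^ 2 ∣ (freyCurve (-1) (2 ^ 13)).conductorNorm ℤ)).card = 1 ∧
    (freyCurve (-1) (2 ^ 13)).conductorNorm ℤ = 16382 ∧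
    multiplicativeValuationProduct (freyCurve (-1) (2 ^ 13)) = 36 := by
  have hp : (mersenne 13).Prime := by norm_num [mersenne]
  have h5 : 5 ≤ 13 := by norm_num
  refine ⟨isElliptic_freyCurve_mersenne (by norm_num), freyCurve_mersenne_hyp₁ h5, ?_, ?_, ?_⟩
  · rw [oddMultiplicativePrimes_freyCurve_mersenne h5, hp.primeFactors, Finset.card_singleton]
  · rw [conductorNorm_freyCurve_mersenne_eq h5, radical_prime hp]; norm_num [mersenne]
  · rw [multiplicativeValuationProduct_freyCurve_mersenne h5, prod_prime hp]

/-- `n = 127` (`2¹²⁷ - 1` prime by Lucas–Lehmer, checked by the kernel): `N = 2 (2¹²⁷ - 1)`, ONE odd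
multiplicative prime, `T = 246 · 2 = 492`. [folklore] -/
theorem fewPrime_witness_127 :
    (freyCurve (-1) (2 ^ 127)).IsElliptic ∧
    (∀ p : ℕ, p.Prime → p ≠ 2 → ¬ p ^ 2 ∣ (freyCurve (-1) (2 ^ 127)).conductorNorm ℤ) ∧
    (((freyCurve (-1) (2 ^ 127)).conductorNorm ℤ).primeFactors.filter
        (fun p => p ≠ 2 ∧ ¬ p ^ 2 ∣ (freyCurve (-1) (2 ^ 127)).conductorNorm ℤ)).card = 1 ∧
    (freyCurve (-1) (2 ^ 127)).conductorNorm ℤ = 2 * mersenne 127 ∧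
    multiplicativeValuationProduct (freyCurve (-1) (2 ^ 127)) = 492 := by
  have hp : (mersenne 127).Prime := lucas_lehmer_sufficiency _ (by norm_num) (by norm_num)
  have h5 : 5 ≤ 127 := by norm_num
  refine ⟨isElliptic_freyCurve_mersenne (by norm_num), freyCurve_mersenne_hyp₁ h5, ?_, ?_, ?_⟩
  · rw [oddMultiplicativePrimes_freyCurve_mersenne h5, hp.primeFactors, Finset.card_singleton]
  · rw [conductorNorm_freyCurve_mersenne_eq h5, radical_prime hp]
  · rw [multiplicativeValuationProduct_freyCurve_mersenne h5, prod_prime hp]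

/-- **Every uniform constant for the few-prime class is `≥ 492`.** [folklore] -/
theorem fewPrimeValuationProduct_uniform_const_ge {C : ℝ}
    (hC : ∀ (W : WeierstrassCurve ℚ) [W.IsElliptic],
      (∀ p : ℕ, p.Prime → p ≠ 2 → ¬ p ^ 2 ∣ W.conductorNorm ℤ) →
      ((W.conductorNorm ℤ).primeFactors.filter
          (fun p => p ≠ 2 ∧ ¬ p ^ 2 ∣ W.conductorNorm ℤ)).card ≤ 3 →
      (multiplicativeValuationProduct W : ℝ) ≤ C) :
    492 ≤ C := by
  obtain ⟨hE, h₁, hcard, -, hT⟩ := fewPrime_witness_127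
  haveI := hE
  have h := hC (freyCurve (-1) (2 ^ 127)) h₁ (by omega)
  rw [hT] at h
  exact_mod_cast h

/-- The verbatim few-prime extension of Mestre–Oesterlé (`T(E) ≤ 5`, true for prime conductor) is
false: `T = 36` at `N = 16382 = 2 · 8191`. [folklore] -/
theorem not_fewPrimeValuationProduct_le_five :
    ¬ ∀ (W : WeierstrassCurve ℚ) [W.IsElliptic],
      (∀ p : ℕ, p.Prime → p ≠ 2 → ¬ p ^ 2 ∣ W.conductorNorm ℤ) →
      ((W.conductorNorm ℤ).primeFactors.filter
          (fun p => p ≠ 2 ∧ ¬ p ^ 2 ∣ W.conductorNorm ℤ)).card ≤ 3 →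
      multiplicativeValuationProduct W ≤ 5 := by
  intro h
  obtain ⟨hE, h₁, hcard, -, hT⟩ := fewPrime_witness_13
  haveI := hE
  have := h (freyCurve (-1) (2 ^ 13)) h₁ (by omega)
  omega

end Literature.NumberTheory.EllipticCurves
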